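import Mathlib
import Literature.Analysis.Convexity.AnisotropicPerimeterPatchesLocal
import Literature.Analysis.Convexity.AnisotropicPerimeterPolytopeUnionPatches
import HarnessLib

/-!
# The localized patch theorem with separation required ONLY for the counted patches; the localized facet sum of a
# finite disjoint union of open polytopes of `ℝ³`

Topic `Literature/Analysis/Convexity`; namespace `Literature.Analysis.Convexity`.
* `facetSum_le_anisotropicPerimeterIn_of_counted_separated` — the localized lower bound
  `ofReal (Σ_{m ∈ M'} h_K(a_m)·|D_m|) ≤ P_K(S; U)` of `AnisotropicPerimeterPatchesLocal.facetSum_le_anisotropicPerimeterIn`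
  (Maggi 2012 (12.2)–(12.3), (20.2), Remark 20.3) with the separation hypothesis required only between a COUNTED patch
  (`m ∈ M'`) and the other patches — the proof of the original uses nothing more (the cut-offs live near compact cores of
  the counted patches); this is the form needed when the uncounted patches touch each other or are the two halves of one
  facet cut by `∂U`;
* `patchSumIn_le_anisotropicPerimeterIn_iUnion_cells` — for a finite disjoint family of bounded open `H`-polytopes
  `Q_i` (data as in `AnisotropicPerimeterPolytopeUnionPatches`: normal forms `J i`, sign-symmetric charts `Φ_c`, open
  facets `oF_i(c)`, nonempty cells `I`) and an OPEN set `U`: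
  `ofReal (Σ_{(i,c)} h_K(c.1)·|Φ_c⁻¹((oF_i(c) ∖ ⋃_{j≠i} cl Q_j) ∩ U)|) ≤ P_K(⋃ Q_i; U)` — the exposed facet parts INSIDE
  `U` are paid by the perimeter localized to `U` (divergence identity `setIntegral_fieldDivergence_iUnion_cells`, each
  exposed patch split into its part inside `U` (counted) and the rest).
Consumer: the Crystal3D texture build (line `TexShadow`, stmt-Ventures-23912): tent facets inside a grain's free zone are
paid by the tent certificate's localized perimeter bound.
[cite: Maggi2012, (12.2)–(12.3) p. 122 and (20.2) p. 258, Remark 20.3; EvansGariepy2015, Thm 5.16 (Gauss–Green), polyhedral case]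
-/

noncomputable section

namespace Literature.Analysis.Convexity

open _root_.MeasureTheory Set
open scoped ENNReal NNReal RealInnerProductSpace Topology
open Literature.MathematicalPhysics.StatisticalMechanics (fieldDivergence)
open Literature.MeasureTheory.Integral

variable {V : Type*} [NormedAddCommGroup V] [InnerProductSpace ℝ V]

/-- **The patch theorem, localized lower bound, separation only for the counted patches** (see the module docstring):
with the divergence identity over finitely many patches, a sub-family `M' ⊆ M` of patches contained in the open set `U`,
each of them disjoint from the closures of all other patches of `M`,
`ofReal (Σ_{m ∈ M'} h_K(a_m)·|D_m|) ≤ anisotropicPerimeterIn K S U` for every compact convex `K ∋ 0`.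
[cite: Maggi2012, (12.2) p. 122 and (20.2) p. 258, Remark 20.3; EvansGariepy2015, Thm 5.16 (Gauss–Green), polyhedral case] -/
theorem facetSum_le_anisotropicPerimeterIn_of_counted_separated [FiniteDimensional ℝ V] [MeasurableSpace V]
    [BorelSpace V] {μ : Type*} (M : Finset μ)
    (Φ : μ → ℝ × ℝ → V) (hΦ : ∀ m ∈ M, Continuous (Φ m))
    (D : μ → Set (ℝ × ℝ)) (hDm : ∀ m ∈ M, MeasurableSet (D m)) (hDf : ∀ m ∈ M, volume (D m) ≠ ⊤)
    (a : μ → V)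
    {S : Set V}
    (hdiv : ∀ η : V → V, ContDiff ℝ 1 η → HasCompactSupport η →
      ∫ x in S, fieldDivergence η x = ∑ m ∈ M, ∫ y in D m, ⟪η (Φ m y), a m⟫)
    {U : Set V} (hU : IsOpen U) (M' : Finset μ) (hM' : M' ⊆ M) (hin : ∀ m ∈ M', Φ m '' D m ⊆ U)
    (hsep : ∀ m ∈ M', ∀ m' ∈ M, m ≠ m' → Disjoint (Φ m '' D m) (closure (Φ m' '' D m')))
    {K : Set V} (hKc : IsCompact K) (hK : Convex ℝ K) (hK0 : (0 : V) ∈ K) :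
    ENNReal.ofReal (∑ m ∈ M', sSup ((fun y => ⟪y, a m⟫) '' K) * (volume (D m)).toReal) ≤
      anisotropicPerimeterIn K S U := by
  classical
  set h : μ → ℝ := fun m => sSup ((fun y => ⟪y, a m⟫) '' K) with hh
  have hpos : ∀ m, 0 ≤ h m := fun m => sSup_inner_nonneg hKc hK0 (a m)
  obtain ⟨kv, hkvK, hkv⟩ : ∃ kv : μ → V, (∀ m, kv m ∈ K) ∧ ∀ m, ⟪kv m, a m⟫ = h m := by
    have := fun m => exists_mem_inner_eq_sSup hKc ⟨0, hK0⟩ (a m)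
    choose kv hkvK hkv using this
    exact ⟨kv, hkvK, hkv⟩
  set Hs : ℝ := ∑ m ∈ M', h m with hHs
  have hHs0 : 0 ≤ Hs := Finset.sum_nonneg fun m _ => hpos m
  refine ENNReal.le_of_forall_pos_le_add fun ε hε _ => ?_
  have hε' : 0 < (ε : ℝ) / (Hs + 1) := div_pos (by exact_mod_cast hε) (by linarith)
  -- compact cores of almost full measure, for the patches of `M'`
  have hcore : ∀ m, m ∈ M' → ∃ C : Set (ℝ × ℝ), C ⊆ D m ∧ IsCompact C ∧
      volume (D m \ C) < ENNReal.ofReal ((ε : ℝ) / (Hs + 1)) :=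
    fun m hm => (hDm m (hM' hm)).exists_isCompact_sdiff_lt (hDf m (hM' hm)) (ENNReal.ofReal_pos.2 hε').ne'
  choose! C hCD hCc hCvol using hcore
  -- cores in `V`; the closed «forbidden» sets: all OTHER patches of `M` and the complement of `U`
  set T : μ → Set V := fun m => Φ m '' C m with hT
  set G : μ → Set V := fun m => (⋃ m' ∈ M.erase m, closure (Φ m' '' D m')) ∪ Uᶜ with hG
  have hTc : ∀ m ∈ M', IsCompact (T m) := fun m hm => (hCc m hm).image (hΦ m (hM' hm))
  have hGc : ∀ m ∈ M', IsClosed (G m) := fun m _ =>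
    (isClosed_biUnion_finset fun m' _ => isClosed_closure).union hU.isClosed_compl
  have hTD : ∀ m ∈ M', T m ⊆ Φ m '' D m := fun m hm => Set.image_mono (hCD m hm)
  have hDG : ∀ m ∈ M', ∀ m' ∈ M, m' ≠ m → Φ m' '' D m' ⊆ G m := by
    intro m _ m' hm' hne x hx
    exact Or.inl (Set.mem_biUnion (Finset.mem_erase.2 ⟨hne, hm'⟩) (subset_closure hx))
  have hTG : ∀ m ∈ M', Disjoint (T m) (G m) := by
    intro m hm
    rw [hG, Set.disjoint_union_right, Set.disjoint_iUnion₂_right]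
    refine ⟨fun m' hm' => ?_, ?_⟩
    · obtain ⟨hne, hm'M⟩ := Finset.mem_erase.1 hm'
      exact Disjoint.mono_left (hTD m hm) (hsep m hm m' hm'M (Ne.symm hne))
    · exact Set.disjoint_compl_right_iff_subset.2 ((hTD m hm).trans (hin m hm))
  have hsubTG : ∀ m ∈ M', ∀ m' ∈ M', m' ≠ m → T m' ⊆ G m :=
    fun m hm m' hm' hne => (hTD m' hm').trans (hDG m hm m' (hM' hm') hne)
  obtain ⟨χ, hχ1, hχc, hχ01, hχs, hχT, hχG, hχsupp⟩ :=
    exists_separated_cutoffs_tsupport M' T G hTc hGc hTG hsubTG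
  -- the field `φ = Σ_{m ∈ M'} χ_m • k_m`
  set φ : V → V := fun x => ∑ m ∈ M', χ m x • kv m with hφ
  have hφ1 : ContDiff ℝ 1 φ := ContDiff.sum fun m hm => (hχ1 m hm).smul contDiff_const
  have hφc : HasCompactSupport φ := by
    have key : ∀ s : Finset μ, s ⊆ M' → HasCompactSupport (fun x : V => ∑ m ∈ s, χ m x • kv m) := by
      intro s
      induction s using Finset.induction_on with
      | empty =>
        intro _
        rw [show (fun x : V => ∑ m ∈ (∅ : Finset μ), χ m x • kv m) = 0 from funext fun x => by simp]
        exact HasCompactSupport.zero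
      | insert i s hi ih =>
        intro hsub
        simp_rw [Finset.sum_insert hi]
        refine HasCompactSupport.add ?_ (ih fun j hj => hsub (Finset.mem_insert_of_mem hj))
        exact (hχc i (hsub (Finset.mem_insert_self i s))).smul_right (f' := fun _ => kv i)
    exact key M' le_rfl
  have hφK : ∀ x, φ x ∈ K := fun x =>
    subconvex_sum_mem hK hK0 (fun m => χ m x) kv (fun m hm => (hχ01 m hm x).1) (hχs x)
      fun m _ => hkvK m
  -- the field is supported inside `U`
  have hφU : tsupport φ ⊆ U := by
    have hF : IsClosed (⋃ m ∈ M', tsupport (χ m)) := isClosed_biUnion_finset fun m _ => isClosed_tsupport _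
    have hFU : (⋃ m ∈ M', tsupport (χ m)) ⊆ U := by
      intro x hx
      obtain ⟨m, hm, hxm⟩ := Set.mem_iUnion₂.1 hx
      by_contra hxU
      exact Set.disjoint_left.1 (hχsupp m hm) hxm (Or.inr hxU)
    refine (closure_minimal ?_ hF).trans hFU
    intro x hx
    rw [Function.mem_support] at hx
    by_contra hnot
    apply hx
    refine Finset.sum_eq_zero fun m hm => ?_
    have : χ m x = 0 := by
      by_contra hne
      exact hnot (Set.mem_iUnion₂.2 ⟨m, hm, subset_tsupport _ hne⟩)
    rw [this, zero_smul]
  -- on a patch of `M'` the field is `χ_m • k_m`; on the other patches of `M` it vanishes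
  have hφon : ∀ m ∈ M', ∀ y ∈ D m, φ (Φ m y) = χ m (Φ m y) • kv m := by
    intro m hm y hy
    rw [hφ]
    simp only
    rw [Finset.sum_eq_single_of_mem m hm]
    intro m' hm' hne
    have hx : Φ m y ∈ G m' := hDG m' hm' m (hM' hm) (Ne.symm hne) (Set.mem_image_of_mem _ hy)
    rw [hχG m' hm' _ hx, zero_smul]
  have hφoff : ∀ m ∈ M, m ∉ M' → ∀ y ∈ D m, φ (Φ m y) = 0 := by
    intro m hm hmM' y hy
    rw [hφ]
    refine Finset.sum_eq_zero fun m' hm' => ?_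
    have hne : m ≠ m' := fun h => hmM' (h ▸ hm')
    have hx : Φ m y ∈ G m' := hDG m' hm' m hm hne (Set.mem_image_of_mem _ hy)
    rw [hχG m' hm' _ hx, zero_smul]
  -- evaluate the divergence integral of `φ` patch by patch
  have hI : ∀ m ∈ M', ∫ y in D m, ⟪φ (Φ m y), a m⟫ = h m * ∫ y in D m, χ m (Φ m y) := by
    intro m hm
    rw [← integral_const_mul]
    refine setIntegral_congr_fun (hDm m (hM' hm)) fun y hy => ?_
    rw [hφon m hm y hy, inner_smul_left, hkv m]
    simp [mul_comm]
  have hI0 : ∀ m ∈ M, m ∉ M' → ∫ y in D m, ⟪φ (Φ m y), a m⟫ = 0 := by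
    intro m hm hmM'
    have h0 : ∫ y in D m, ⟪φ (Φ m y), a m⟫ = ∫ y in D m, (0 : ℝ) :=
      setIntegral_congr_fun (hDm m hm) fun y hy => by rw [hφoff m hm hmM' y hy, inner_zero_left]
    rw [h0, integral_zero]
  have hIge : ∀ m ∈ M', (volume (D m)).toReal - (ε : ℝ) / (Hs + 1) ≤ ∫ y in D m, χ m (Φ m y) := by
    intro m hm
    have hCfin : volume (C m) ≠ ⊤ := (lt_of_le_of_lt (measure_mono (hCD m hm))
      (lt_top_iff_ne_top.2 (hDf m (hM' hm)))).ne
    have hsplit : volume (D m) ≤ volume (C m) + volume (D m \ C m) := by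
      calc volume (D m) ≤ volume (C m ∪ (D m \ C m)) := measure_mono (fun y hy => by
              by_cases h : y ∈ C m; exact Or.inl h; exact Or.inr ⟨hy, h⟩)
        _ ≤ volume (C m) + volume (D m \ C m) := measure_union_le _ _
    have h1 : volume (D m) ≤ volume (C m) + ENNReal.ofReal ((ε : ℝ) / (Hs + 1)) :=
      hsplit.trans (add_le_add le_rfl (hCvol m hm).le)
    have h2 := ENNReal.toReal_mono (ENNReal.add_ne_top.2 ⟨hCfin, ENNReal.ofReal_ne_top⟩) h1
    rw [ENNReal.toReal_add hCfin ENNReal.ofReal_ne_top, ENNReal.toReal_ofReal hε'.le] at h2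
    have hCmeas : MeasurableSet (C m) := (hCc m hm).isClosed.measurableSet
    have hint : IntegrableOn (fun y => χ m (Φ m y)) (D m) volume :=
      integrableOn_of_continuous_of_bound ((hχ1 m hm).continuous.comp' (hΦ m (hM' hm))) (C := 1)
        (fun y => by
          rw [Real.norm_eq_abs, abs_le]
          exact ⟨by linarith [(hχ01 m hm (Φ m y)).1], (hχ01 m hm (Φ m y)).2⟩) (hDf m (hM' hm))
    have h3 : ∫ y in D m, (C m).indicator (fun _ => (1 : ℝ)) y ≤ ∫ y in D m, χ m (Φ m y) := by
      have hindint : IntegrableOn (fun y => (C m).indicator (fun _ => (1 : ℝ)) y) (D m) volume :=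
        ((integrable_indicator_iff hCmeas).2 (integrableOn_const hCfin)).integrableOn
      refine setIntegral_mono hindint hint fun y => ?_
      by_cases hy : y ∈ C m
      · rw [Set.indicator_of_mem hy, hχT m hm _ (Set.mem_image_of_mem _ hy)]
      · rw [Set.indicator_of_notMem hy]; exact (hχ01 m hm _).1
    have h4 : ∫ y in D m, (C m).indicator (fun _ => (1 : ℝ)) y = (volume (C m)).toReal := by
      rw [setIntegral_indicator hCmeas, Set.inter_eq_self_of_subset_right (hCD m hm),
        setIntegral_const, smul_eq_mul, mul_one, measureReal_def]
    linarith
  -- sum up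
  have hsum : ∑ m ∈ M', h m * (volume (D m)).toReal ≤ (∫ x in S, fieldDivergence φ x) + ε := by
    rw [hdiv φ hφ1 hφc]
    -- the patches outside `M'` contribute nothing
    have hsplit : ∑ m ∈ M, ∫ y in D m, ⟪φ (Φ m y), a m⟫ = ∑ m ∈ M', ∫ y in D m, ⟪φ (Φ m y), a m⟫ := by
      rw [← Finset.sum_subset hM' (fun m hm hmM' => hI0 m hm hmM')]
    rw [hsplit]
    have h1 : ∀ m ∈ M', h m * (volume (D m)).toReal ≤
        (∫ y in D m, ⟪φ (Φ m y), a m⟫) + h m * ((ε : ℝ) / (Hs + 1)) := by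
      intro m hm
      rw [hI m hm]
      nlinarith [hpos m, hIge m hm]
    have h2 := Finset.sum_le_sum h1
    rw [Finset.sum_add_distrib, ← Finset.sum_mul] at h2
    have h3 : Hs * ((ε : ℝ) / (Hs + 1)) ≤ ε := by
      rw [mul_div_assoc', div_le_iff₀ (by linarith)]
      nlinarith [hHs0, (show (0:ℝ) ≤ ε from by exact_mod_cast hε.le)]
    linarith
  calc ENNReal.ofReal (∑ m ∈ M', h m * (volume (D m)).toReal)
      ≤ ENNReal.ofReal ((∫ x in S, fieldDivergence φ x) + ε) := ENNReal.ofReal_le_ofReal hsum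
    _ ≤ ENNReal.ofReal (∫ x in S, fieldDivergence φ x) + ENNReal.ofReal ε := ENNReal.ofReal_add_le
    _ ≤ anisotropicPerimeterIn K S U + ε := by
        rw [ENNReal.ofReal_coe_nnreal]
        exact add_le_add (le_anisotropicPerimeterIn hφ1 hφc hφK hφU) le_rfl

/-- **Localized facet sum of a finite disjoint union of bounded open polytopes**: with the patches
`D_{ic} = Φ_c⁻¹(oF_i(c) ∖ ⋃_{j ≠ i} closure Q_j)` of `setIntegral_fieldDivergence_iUnion_cells` and an open set `U`,
`ofReal (Σ_{(i,c)} h_K(c.1) · |Φ_c⁻¹((oF_i(c) ∖ ⋃_{j≠i} closure Q_j) ∩ U)|) ≤ P_K(⋃ Q_i; U)` for every compact convex `K ∋ 0`.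
[cite: Maggi2012, (12.2)–(12.3) p. 122, (20.2) p. 258 and Remark 20.3; EvansGariepy2015, Thm 5.16 (Gauss–Green), polyhedral case] -/
theorem patchSumIn_le_anisotropicPerimeterIn_iUnion_cells {k : ℕ}
    (H : Fin k → Finset (EuclideanSpace ℝ (Fin 3) × ℝ)) (Q : Fin k → Set (EuclideanSpace ℝ (Fin 3)))
    (hQ : ∀ i, Q i = ⋂ p ∈ H i, {x : EuclideanSpace ℝ (Fin 3) | ⟪p.1, x⟫ < p.2})
    (J : Fin k → Finset (EuclideanSpace ℝ (Fin 3) × ℝ))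
    (hJ : ∀ i, J i = ((H i).filter (fun p => p.1 ≠ 0)).image (fun p => (‖p.1‖⁻¹ • p.1, ‖p.1‖⁻¹ * p.2)))
    (fU fV : EuclideanSpace ℝ (Fin 3) → EuclideanSpace ℝ (Fin 3))
    (hfr : ∀ a, ‖a‖ = 1 → ‖fU a‖ = 1 ∧ ‖fV a‖ = 1 ∧ ⟪fU a, fV a⟫ = 0 ∧ ⟪a, fU a⟫ = 0 ∧ ⟪a, fV a⟫ = 0)
    (hsym : ∀ a, fU (-a) = fU a ∧ fV (-a) = fV a)
    (Φ : EuclideanSpace ℝ (Fin 3) × ℝ → ℝ × ℝ → EuclideanSpace ℝ (Fin 3))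
    (hΦ : ∀ c y, Φ c y = c.2 • c.1 + y.1 • fU c.1 + y.2 • fV c.1)
    (oF : Fin k → EuclideanSpace ℝ (Fin 3) × ℝ → Set (EuclideanSpace ℝ (Fin 3)))
    (hoF : ∀ i c, oF i c = {x | ⟪c.1, x⟫ = c.2 ∧ ∀ c' ∈ J i, c' ≠ c → ⟪c'.1, x⟫ < c'.2})
    (I : Finset (Fin k)) (hI : ∀ i, i ∈ I ↔ (Q i).Nonempty)
    (hbd : ∀ i, Bornology.IsBounded (Q i)) (hdisj : ∀ i j, i ≠ j → Disjoint (Q i) (Q j))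
    {U : Set (EuclideanSpace ℝ (Fin 3))} (hU : IsOpen U)
    {K : Set (EuclideanSpace ℝ (Fin 3))} (hKc : IsCompact K) (hK : Convex ℝ K)
    (hK0 : (0 : EuclideanSpace ℝ (Fin 3)) ∈ K) :
    ENNReal.ofReal (∑ m ∈ I.sigma J, sSup ((fun y => ⟪y, m.2.1⟫) '' K) *
        (volume (Φ m.2 ⁻¹' ((oF m.1 m.2 \ ⋃ j ∈ I.erase m.1, closure (Q j)) ∩ U))).toReal) ≤
      anisotropicPerimeterIn K (⋃ i, Q i) U := by
  classical
  have hmeas_oF : ∀ j e, MeasurableSet (oF j e) := fun j e => by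
    rw [hoF]; exact measurableSet_openFacet (J j) e
  have hWc : ∀ i, IsClosed (⋃ j ∈ I.erase i, closure (Q j)) :=
    fun i => isClosed_biUnion_finset fun j _ => isClosed_closure
  have hΦcont : ∀ c, Continuous (Φ c) := fun c => by rw [funext (hΦ c)]; fun_prop
  -- the patch of `m` and its two halves
  set Pt : (Σ _ : Fin k, EuclideanSpace ℝ (Fin 3) × ℝ) → Set (EuclideanSpace ℝ (Fin 3)) := fun m =>
    oF m.1 m.2 \ ⋃ j ∈ I.erase m.1, closure (Q j) with hPt
  have hPtm : ∀ m, MeasurableSet (Pt m) := fun m => (hmeas_oF m.1 m.2).diff (hWc m.1).measurableSet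
  set D : (Σ _ : Fin k, EuclideanSpace ℝ (Fin 3) × ℝ) × Bool → Set (ℝ × ℝ) := fun mb =>
    cond mb.2 (Φ mb.1.2 ⁻¹' (Pt mb.1 ∩ U)) (Φ mb.1.2 ⁻¹' (Pt mb.1 \ U)) with hD
  have hDt : ∀ m, D (m, true) = Φ m.2 ⁻¹' (Pt m ∩ U) := fun m => rfl
  have hDf' : ∀ m, D (m, false) = Φ m.2 ⁻¹' (Pt m \ U) := fun m => rfl
  have hDm : ∀ mb, MeasurableSet (D mb) := by
    rintro ⟨m, b⟩
    cases b
    · rw [hDf']; exact ((hPtm m).diff hU.measurableSet).preimage (hΦcont m.2).measurable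
    · rw [hDt]; exact ((hPtm m).inter hU.measurableSet).preimage (hΦcont m.2).measurable
  -- finiteness: every patch piece sits in the compact chart preimage of `closure (Q i)`
  have hfin : ∀ m ∈ I.sigma J, ∀ S ⊆ Pt m, volume (Φ m.2 ⁻¹' S) ≠ ⊤ := by
    intro m hm S hS
    obtain ⟨hi, hc⟩ := Finset.mem_sigma.1 hm
    obtain ⟨-, h1i, -, hcli⟩ := cell_normalForm H Q hQ J hJ ((hI m.1).1 hi)
    obtain ⟨hU1, hV1, hUV, -, -⟩ := hfr m.2.1 (h1i m.2 hc)
    have hcpt : IsCompact (closure (Q m.1)) :=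
      Metric.isCompact_of_isClosed_isBounded isClosed_closure (hbd m.1).closure
    have hsub : Φ m.2 ⁻¹' S ⊆ Φ m.2 ⁻¹' closure (Q m.1) := by
      refine Set.preimage_mono (hS.trans (Set.sdiff_subset.trans ?_))
      rw [hoF, hcli]; exact openFacet_subset_closedHPolytope (J m.1)
    refine (lt_of_le_of_lt (measure_mono hsub) ?_).ne
    rw [funext (hΦ m.2)]
    exact (isCompact_chartPreimage m.2 (fU m.2.1) (fV m.2.1) hU1 hV1 hUV hcpt).measure_lt_top
  have hDfin : ∀ mb ∈ (I.sigma J) ×ˢ (Finset.univ : Finset Bool), volume (D mb) ≠ ⊤ := by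
    rintro ⟨m, b⟩ hmb
    have hm : m ∈ I.sigma J := (Finset.mem_product.1 hmb).1
    cases b
    · rw [hDf']; exact hfin m hm _ Set.sdiff_subset
    · rw [hDt]; exact hfin m hm _ Set.inter_subset_left
  -- the original patches are separated
  have hsepPt : ∀ m ∈ I.sigma J, ∀ m' ∈ I.sigma J, m ≠ m' → Disjoint (Pt m) (closure (Pt m')) := by
    intro m hm m' hm' hmm'
    obtain ⟨hi, hc⟩ := Finset.mem_sigma.1 hm
    obtain ⟨hi', hc'⟩ := Finset.mem_sigma.1 hm'
    by_cases hii : m.1 = m'.1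
    · have hcc : m.2 ≠ m'.2 := fun h => hmm' (Sigma.ext hii (heq_of_eq h))
      refine Disjoint.mono Set.sdiff_subset (closure_mono Set.sdiff_subset) ?_
      rw [hoF, hoF, hii]
      exact disjoint_openFacet_closure_openFacet (J m'.1) hc' (Ne.symm hcc)
    · obtain ⟨-, -, -, hcli'⟩ := cell_normalForm H Q hQ J hJ ((hI m'.1).1 hi')
      have h1 : closure (Pt m') ⊆ closure (Q m'.1) := by
        refine closure_minimal (Set.sdiff_subset.trans ?_) isClosed_closure
        rw [hoF, hcli']; exact openFacet_subset_closedHPolytope (J m'.1)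
      have h2 : Pt m ⊆ (closure (Q m'.1))ᶜ := by
        intro x hx hx'
        exact hx.2 (Set.mem_biUnion (Finset.mem_erase.2 ⟨Ne.symm hii, hi'⟩) hx')
      exact Disjoint.mono h2 h1 disjoint_compl_left
  -- apply the weak-separation patch theorem
  have key := facetSum_le_anisotropicPerimeterIn_of_counted_separated ((I.sigma J) ×ˢ (Finset.univ : Finset Bool))
    (fun mb => Φ mb.1.2) (fun mb _ => hΦcont mb.1.2) D (fun mb _ => hDm mb) hDfin (fun mb => mb.1.2.1)
    (S := ⋃ i, Q i) ?_ hU ((I.sigma J) ×ˢ ({true} : Finset Bool))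
    (Finset.product_subset_product_right (Finset.subset_univ _)) ?_ ?_ hKc hK hK0
  · -- rewrite the counted sum
    refine le_trans (le_of_eq ?_) key
    congr 1
    rw [Finset.sum_product]
    refine Finset.sum_congr rfl fun m _ => ?_
    rw [Finset.sum_singleton, hDt]
  · -- the divergence identity: each patch integral splits into its two halves
    intro η hη hηc
    rw [setIntegral_fieldDivergence_iUnion_cells H Q hQ J hJ fU fV hfr hsym Φ hΦ oF hoF I hI hbd hdisj hη hηc,
      Finset.sum_product]
    refine Finset.sum_congr rfl fun m hm => ?_
    rw [Fintype.sum_bool, hDt, hDf']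
    have hg : Integrable (fun y : ℝ × ℝ => ⟪η (Φ m.2 y), m.2.1⟫) volume := by
      obtain ⟨-, hc⟩ := Finset.mem_sigma.1 hm
      obtain ⟨-, h1i, -, -⟩ := cell_normalForm H Q hQ J hJ ((hI m.1).1 (Finset.mem_sigma.1 hm).1)
      obtain ⟨hU1, hV1, hUV, -, -⟩ := hfr m.2.1 (h1i m.2 hc)
      refine Continuous.integrable_of_hasCompactSupport (by fun_prop) ?_
      refine HasCompactSupport.intro ((funext (hΦ m.2)) ▸ isCompact_chartPreimage m.2 (fU m.2.1) (fV m.2.1)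
        hU1 hV1 hUV hηc.isCompact) fun y hy => ?_
      rw [image_eq_zero_of_notMem_tsupport (fun h => hy h), inner_zero_left]
    have hsplit : Φ m.2 ⁻¹' Pt m = Φ m.2 ⁻¹' (Pt m ∩ U) ∪ Φ m.2 ⁻¹' (Pt m \ U) := by
      rw [← Set.preimage_union, Set.inter_union_sdiff]
    have hdj : Disjoint (Φ m.2 ⁻¹' (Pt m ∩ U)) (Φ m.2 ⁻¹' (Pt m \ U)) :=
      (Set.disjoint_sdiff_inter (s := Pt m) (t := U)).symm.preimage _
    show ∫ y in Φ m.2 ⁻¹' (oF m.1 m.2 \ ⋃ j ∈ I.erase m.1, closure (Q j)), ⟪η (Φ m.2 y), m.2.1⟫ = _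
    rw [show Φ m.2 ⁻¹' (oF m.1 m.2 \ ⋃ j ∈ I.erase m.1, closure (Q j)) = Φ m.2 ⁻¹' Pt m from rfl, hsplit,
      setIntegral_union hdj (((hPtm m).diff hU.measurableSet).preimage (hΦcont m.2).measurable)
        hg.integrableOn hg.integrableOn]
  · -- counted patches lie inside `U`
    rintro ⟨m, b⟩ hmb
    have hb : b = true := Finset.mem_singleton.1 (Finset.mem_product.1 hmb).2
    subst hb
    rw [hDt]
    exact (Set.image_preimage_subset _ _).trans Set.inter_subset_right
  · -- separation of a counted patch from every other patch
    rintro ⟨m, b⟩ hmb ⟨m', b'⟩ hmb' hne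
    have hb : b = true := Finset.mem_singleton.1 (Finset.mem_product.1 hmb).2
    subst hb
    have hm : m ∈ I.sigma J := (Finset.mem_product.1 hmb).1
    have hm' : m' ∈ I.sigma J := (Finset.mem_product.1 hmb').1
    rw [hDt]
    by_cases hmm : m = m'
    · subst hmm
      have hb' : b' = false := by
        cases b'
        · rfl
        · exact absurd rfl hne
      subst hb'
      rw [hDf']
      exact Disjoint.mono ((Set.image_preimage_subset _ _).trans Set.inter_subset_right)
        (closure_minimal ((Set.image_preimage_subset _ _).trans fun x hx => hx.2) hU.isClosed_compl)
        disjoint_compl_right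
    · refine Disjoint.mono ((Set.image_preimage_subset _ _).trans Set.inter_subset_left)
        (closure_mono ?_) (hsepPt m hm m' hm' hmm)
      cases b'
      · rw [hDf']; exact (Set.image_preimage_subset _ _).trans Set.sdiff_subset
      · rw [hDt]; exact (Set.image_preimage_subset _ _).trans Set.inter_subset_left

end Literature.Analysis.Convexity

end
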